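import Literature.AlgebraicGeometry.HodgeTheory.VHSDataComapCharts
import HarnessLib

/-!
# Interior period charts pull back along maps that are HOLOMORPHIC IN THE CHARTS: the interior half of «locally charted» for `g^*D` along any
# holomorphic map `g : S′ → S` of one-dimensional bases, from interior charts of `D`

Topic `Literature/AlgebraicGeometry/HodgeTheory` (namespaces `Literature.AlgebraicGeometry.HodgeTheory` for the coordinate bookkeeping,
`Literature.AlgebraicGeometry.Motives.VHSData[.InteriorChart]` for the charts), lane `lit-hodgefound` (seat `p08`, row g60-#11).  DEFINITIONS WITH BODIES
(`HodgeTheory.rerouteParam` ∕ **`HodgeTheory.rerouteChart`** — a coordinate chart `χ` of `S′` restricted to an open `U ⊆ S′` with its inverse re-routed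
off the target so as to land in `U` for EVERY parameter —, and **`InteriorChart.comapAnalytic`** — the interior chart of `g^*D` on a chart `χ` of `S′`
induced by an interior chart of `D` on a disc `ψ₀` of `S` and a reindexing `j` ANALYTIC on `χ.target`, `g(χ⁻¹ c) = ψ₀⁻¹(j c)`) and THEOREMS; no
named fact, no instance, no notation (D-0026 net debt `0`).  Generalizes the tree's `InteriorChart.transfer` (`VHSDataComapCharts`: the reindexing is
the identity on the target — the case of a local homeomorphism `g` read in the charts `ψ ∘ e` of its sheets) to arbitrary holomorphic reindexings:
ramified covers at their unramified points, non-constant holomorphic maps between curves, holomorphic changes of the coordinate disc.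

PRINTED SOURCES, VERBATIM.  P. Griffiths, *Periods of integrals on algebraic manifolds III*, Publ. Math. IHÉS 38 (1970), §9 ∕ W. Schmid, *Variation of
Hodge structure: the singularities of the period mapping*, Invent. Math. 22 (1973), §2: a variation of Hodge structure PULLS BACK along a holomorphic map
of the base, its period map being the composite `Φ ∘ g` (in a flat frame the Hodge filtration of `g^*𝒱` at `s′` is that of `𝒱` at `g(s′)`, a
holomorphic function of `s′`).  E. Cattani, P. Deligne, A. Kaplan, *On the locus of Hodge classes*, J. AMS 8 (1995), §1 (pp. 483–484): «at `h ∈ H_ℤ`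
of type `(p, p)`, the locus `T ⊂ U` where `h` remains of type `(p, p)` … is a complex analytic subspace of `U`» — a statement local on the base and
stable under holomorphic base change.  P. Deligne, *Équations différentielles à points singuliers réguliers*, LNM 163 (1970), I.1:
`(g^*𝒱)_{s′} = 𝒱_{g(s′)}` (the tree's `VHSData.comap`, `comap_V_fiber … := rfl`).  K. Fritzsche, H. Grauert, *From Holomorphic Functions to Complex
Manifolds*, GTM 213 (2002), Ch. I §8 (coordinate balls), Ch. IV §1 (holomorphic maps of Riemann surfaces read in charts: `ψ ∘ g ∘ χ⁻¹` holomorphic).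

CONTENT.
* §1 **`rerouteChart χ U hU`** (`U ⊆ S′` open): source `χ.source ∩ U`, target `χ.target ∩ (χ⁻¹)⁻¹ U`, map `χ`, inverse `χ⁻¹ ∘ rerouteParam` with
  `rerouteParam c = c` on the target and a fixed good parameter elsewhere (Hilbert's `ε`; documented junk) — so that `(rerouteChart χ U hU)⁻¹ c ∈ U` for
  EVERY `c` as soon as the target is nonempty (`symm_rerouteChart_mem`).
* §2 **`InteriorChart.comapAnalytic g C χ j hj hjt hja hconn`**: from an interior chart `C` of `D` on the disc `ψ₀`, a chart `χ` of `S′` with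
  preconnected target, a reindexing `j : ℂ → ℂ` with `g(χ⁻¹ c) = ψ₀⁻¹(j c)` for every `c`, `j(χ.target) ⊆ ψ₀.target` and `j` ANALYTIC on `χ.target`:
  the interior chart of `g^*D` on `χ` with trivialization `e_{j c} ∘ fiberCast`, frame `h ∘ j` (holomorphic as a composite), the same reference
  structure, lattice and constant; **`IsFlat.comapAnalytic`** (flatness when `g(χ.source) ⊆ ψ₀.source`).
* §3 **`IsLocallyCharted.comap_of_analytic`** ∕ **`IsLocallyFlatCharted.comap_of_analytic`**: `g : S′ → S` continuous, charts `χ_b` of `S′`, discs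
  `ψ_a` of `S` such that every `ψ_a ∘ g ∘ χ_b⁻¹` is ANALYTIC where defined («`g` holomorphic»), (flat) interior charts of `D` on coordinate balls around
  every point of every disc `ψ_a`, and (flat) puncture charts of `g^*D` along ends `σ′ i` of `S′` ⟹ `g^*D` is locally (flat-)charted for the charts
  `rerouteChart (χ b) (g⁻¹ ψ_a.source)`; their sources cover `S′` when the `χ_b` cover `S′` and the `ψ_a` cover `S`
  (`exists_mem_rerouteChart_source`).

HONEST SCOPE.  Interior charts only: puncture charts do NOT pull back along ramified maps (the monodromy logarithm changes), and no statement about them is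
made; charts remain HYPOTHESIS structures; «holomorphic» is the chartwise analyticity hypothesis `han`, nothing more.

## References

* [Griffiths1970PeriodsIII] P. Griffiths, *Periods of integrals on algebraic manifolds III*, Publ. Math. IHÉS 38 (1970), §9.
* [Schmid1973] W. Schmid, *Variation of Hodge structure: the singularities of the period mapping*, Invent. Math. 22 (1973), §2.
* [CattaniDeligneKaplan1995] E. Cattani, P. Deligne, A. Kaplan, *On the locus of Hodge classes*, J. Amer. Math. Soc. 8 (1995) 483–506, §1 (pp. 483–484).
* [Deligne1970] P. Deligne, *Équations différentielles à points singuliers réguliers*, LNM 163 (1970), I.1.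
* [FritzscheGrauert2002] K. Fritzsche, H. Grauert, *From Holomorphic Functions to Complex Manifolds*, GTM 213 (2002), Ch. I §8, Ch. IV §1.
-/

noncomputable section

open scoped TensorProduct ComplexOrder
open _root_.Topology _root_.Filter Set

universe u

namespace Literature.AlgebraicGeometry

open Motives Motives.HodgeStructure HodgeTheory Topology
open Motives.HodgeStructure (conj ofRat ofRat_apply conj_ofRat)

/-! ## §1 A coordinate chart restricted to an open set, with its inverse re-routed into the set -/

namespace HodgeTheory

variable {S' : Type} [TopologicalSpace S'] (χ : OpenPartialHomeomorph S' ℂ) (U : Set S')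

open scoped Classical in
/-- The «good» reindexing of `ℂ` attached to a chart `χ` and a set `U`: the identity at the parameters `c ∈ χ.target` with `χ⁻¹ c ∈ U`, and a fixed such
parameter (Hilbert's `ε`) elsewhere — documented junk making the re-routed inverse land in `U` for every parameter. [cite: FritzscheGrauert2002, Ch. I §8] -/
def rerouteParam (c : ℂ) : ℂ :=
  if c ∈ χ.target ∧ χ.symm c ∈ U then c else Classical.epsilon fun c' : ℂ => c' ∈ χ.target ∧ χ.symm c' ∈ U

/-- `rerouteParam` is the identity at the good parameters. [cite: FritzscheGrauert2002, Ch. I §8] -/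
theorem rerouteParam_of_mem {c : ℂ} (hc : c ∈ χ.target ∧ χ.symm c ∈ U) : rerouteParam χ U c = c := by
  rw [rerouteParam, if_pos hc]

/-- If some parameter is good, every value of `rerouteParam` is good. [cite: FritzscheGrauert2002, Ch. I §8] -/
theorem rerouteParam_mem (hne : ∃ c : ℂ, c ∈ χ.target ∧ χ.symm c ∈ U) (c : ℂ) : rerouteParam χ U c ∈ χ.target ∧ χ.symm (rerouteParam χ U c) ∈ U := by
  by_cases hc : c ∈ χ.target ∧ χ.symm c ∈ U
  · rwa [rerouteParam_of_mem χ U hc]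
  · rw [rerouteParam, if_neg hc]
    exact Classical.epsilon_spec hne

open scoped Classical in
/-- **The chart `χ` restricted to the open set `U`, with re-routed inverse**: source `χ.source ∩ U`, target `χ.target ∩ (χ⁻¹)⁻¹ U`, map `χ`, inverse
`c ↦ χ⁻¹(rerouteParam c)` (`= χ⁻¹ c` on the target). [cite: FritzscheGrauert2002, Ch. I §8] -/
def rerouteChart (hU : IsOpen U) : OpenPartialHomeomorph S' ℂ where
  toFun := χ
  invFun c := χ.symm (rerouteParam χ U c)
  source := χ.source ∩ U
  target := χ.target ∩ χ.symm ⁻¹' U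
  map_source' x hx := ⟨χ.map_source hx.1, by rw [mem_preimage, χ.left_inv hx.1]; exact hx.2⟩
  map_target' c hc := by
    rw [rerouteParam_of_mem χ U hc]
    exact ⟨χ.map_target hc.1, hc.2⟩
  left_inv' x hx := by
    have h1 : χ.symm (χ x) = x := χ.left_inv hx.1
    have h2 : χ x ∈ χ.target ∧ χ.symm (χ x) ∈ U := ⟨χ.map_source hx.1, by rw [h1]; exact hx.2⟩
    simp only [rerouteParam_of_mem χ U h2, h1]
  right_inv' c hc := by
    simp only [rerouteParam_of_mem χ U hc, χ.right_inv hc.1]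
  open_source := χ.open_source.inter hU
  open_target := χ.isOpen_inter_preimage_symm hU
  continuousOn_toFun := χ.continuousOn.mono inter_subset_left
  continuousOn_invFun := by
    refine (χ.continuousOn_symm.mono inter_subset_left).congr ?_
    intro c hc
    have hc' : c ∈ χ.target ∧ χ.symm c ∈ U := hc
    simp only [rerouteParam_of_mem χ U hc']

variable {U} (hU : IsOpen U)

/-- `rerouteChart χ U hU x = χ x`. [cite: FritzscheGrauert2002, Ch. I §8] -/
@[simp] theorem rerouteChart_apply (x : S') : rerouteChart χ U hU x = χ x := rfl

/-- The inverse of `rerouteChart χ U hU`. [cite: FritzscheGrauert2002, Ch. I §8] -/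
theorem rerouteChart_symm_apply (c : ℂ) : (rerouteChart χ U hU).symm c = χ.symm (rerouteParam χ U c) := rfl

/-- The source of `rerouteChart χ U hU`. [cite: FritzscheGrauert2002, Ch. I §8] -/
theorem rerouteChart_source : (rerouteChart χ U hU).source = χ.source ∩ U := rfl

/-- The target of `rerouteChart χ U hU`. [cite: FritzscheGrauert2002, Ch. I §8] -/
theorem rerouteChart_target : (rerouteChart χ U hU).target = χ.target ∩ χ.symm ⁻¹' U := rfl

/-- On the target the re-routed inverse is `χ⁻¹`. [cite: FritzscheGrauert2002, Ch. I §8] -/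
theorem rerouteChart_symm_apply_of_mem {c : ℂ} (hc : c ∈ (rerouteChart χ U hU).target) : (rerouteChart χ U hU).symm c = χ.symm c := by
  rw [rerouteChart_symm_apply, rerouteParam_of_mem χ U hc]

/-- **The re-routed inverse lands in `U` for EVERY parameter** as soon as the restricted chart has a point. [cite: FritzscheGrauert2002, Ch. I §8] -/
theorem symm_rerouteChart_mem {x : S'} (hx : x ∈ (rerouteChart χ U hU).source) (c : ℂ) : (rerouteChart χ U hU).symm c ∈ U :=
  (rerouteParam_mem χ U ⟨χ x, (rerouteChart χ U hU).map_source hx⟩ c).2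

/-- The sources of the re-routed charts `rerouteChart (χ b) (g⁻¹ ψ_a.source)` cover `S′` when the `χ b` cover `S′` and the `ψ a` cover `S`.
[cite: FritzscheGrauert2002, Ch. IV §1] -/
theorem exists_mem_rerouteChart_source {S : Type} [TopologicalSpace S] {α β : Type*} (ψ : α → OpenPartialHomeomorph S ℂ)
    (χ : β → OpenPartialHomeomorph S' ℂ) (g : C(S', S)) (hcov : ∀ y : S, ∃ a, y ∈ (ψ a).source) (hcov' : ∀ x : S', ∃ b, x ∈ (χ b).source)
    (x : S') :
    ∃ ab : α × β, x ∈ (rerouteChart (χ ab.2) (g ⁻¹' (ψ ab.1).source) ((ψ ab.1).open_source.preimage g.continuous)).source := by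
  obtain ⟨b, hb⟩ := hcov' x
  obtain ⟨a, ha⟩ := hcov (g x)
  exact ⟨(a, b), hb, ha⟩

end HodgeTheory

/-! ## §2 The interior chart of `g^*D` induced by an interior chart of `D` and an analytic reindexing -/

namespace Motives.VHSData.InteriorChart

variable {S S' : Type} [TopologicalSpace S] [TopologicalSpace S'] {k : ℤ} {D : VHSData S k} (g : C(S', S))
variable {V : Type u} [AddCommGroup V] [Module ℚ V] {H₀ : HodgeStructure V k} {P₀ : H₀.Polarization}
variable {ψ₀ : OpenPartialHomeomorph S ℂ} (C : D.InteriorChart ψ₀ P₀) (χ : OpenPartialHomeomorph S' ℂ) (j : ℂ → ℂ)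
  (hj : ∀ c : ℂ, g (χ.symm c) = ψ₀.symm (j c)) (hjt : MapsTo j χ.target ψ₀.target) (hja : AnalyticOnNhd ℂ j χ.target)
  (hconn : IsPreconnected χ.target)

include hjt in
/-- Hodge filtration in the induced trivialization (honest fibre types). [cite: Schmid1973, §2] [cite: CattaniDeligneKaplan1995, §1 (p. 483)] -/
private theorem comapAnalytic_map_F_aux {c : ℂ} (hc : c ∈ χ.target) (q : ℤ) :
    ((D.hodge (g (χ.symm c))).F q).map (((D.fiberCast (hj c)).trans (C.e (j c))).toLinearMap.baseChange ℂ) = (H₀.F q).comap (C.h (j c)) := by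
  rw [LinearEquiv.coe_trans, LinearMap.baseChange_comp, Submodule.map_comp, D.map_hodge_F_fiberCast (hj c) q, C.map_F_eq (j c) (hjt hc) q]

include hjt in
/-- Polarization in the induced trivialization (honest fibre types). [cite: Schmid1973, §2] -/
private theorem comapAnalytic_form_aux {c : ℂ} (hc : c ∈ χ.target) (x y : D.V.fiber (g (χ.symm c))) :
    (D.form (g (χ.symm c))).form x y = P₀.form (C.e (j c) (D.fiberCast (hj c) x)) (C.e (j c) (D.fiberCast (hj c) y)) := by
  rw [← C.form_eq (j c) (hjt hc), D.form_fiberCast (hj c)]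

include hjt in
/-- Integral vectors in the induced trivialization land in `Λ` (honest fibre types). [cite: Schmid1973, §2] -/
private theorem comapAnalytic_toRat_mem_aux {c : ℂ} (hc : c ∈ χ.target) (u : D.VZ.fiber (g (χ.symm c))) :
    C.e (j c) (D.fiberCast (hj c) (D.toRat (g (χ.symm c)) u)) ∈ C.Λ := by
  rw [D.fiberCast_toRat (hj c)]
  exact C.e_toRat_mem (j c) (hjt hc) _

include hjt in
/-- `Λ` is attained by integral vectors in the induced trivialization (honest fibre types). [cite: Schmid1973, §2] -/
private theorem comapAnalytic_exists_toRat_aux {c : ℂ} (hc : c ∈ χ.target) (v : V) (hv : v ∈ C.Λ) :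
    ∃ u : D.VZ.fiber (g (χ.symm c)), C.e (j c) (D.fiberCast (hj c) (D.toRat (g (χ.symm c)) u)) = v := by
  obtain ⟨u, hu⟩ := C.exists_e_toRat_eq (j c) (hjt hc) v hv
  refine ⟨(D.fiberCastZ (hj c)).symm u, ?_⟩
  rw [D.fiberCast_toRat (hj c), LinearEquiv.apply_symm_apply, hu]

include hjt in
/-- Metric comparison in the induced trivialization (honest fibre types). [cite: CattaniDeligneKaplan1995, §1 (p. 484)] -/
private theorem comapAnalytic_hodgeNorm_aux {c : ℂ} (hc : c ∈ χ.target) (x : ℂ ⊗[ℚ] D.V.fiber (g (χ.symm c))) :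
    C.κ * P₀.hodgeNorm ((((D.fiberCast (hj c)).trans (C.e (j c))).toLinearMap.baseChange ℂ) x) ≤ (D.form (g (χ.symm c))).hodgeNorm x := by
  rw [LinearEquiv.coe_trans, LinearMap.baseChange_comp, LinearMap.comp_apply, ← D.hodgeNorm_fiberCast (hj c) x]
  exact C.mul_hodgeNorm_le (j c) (hjt hc) _

/-- **THE INTERIOR CHART OF `g^*D` INDUCED BY AN INTERIOR CHART OF `D` AND AN ANALYTIC REINDEXING** («the period map of `g^*𝒱` is `Φ ∘ g`»): `C` an
interior chart of `D` on the disc `ψ₀` of `S`, `χ` a chart of `S′` with preconnected target, `j : ℂ → ℂ` with `g(χ⁻¹ c) = ψ₀⁻¹(j c)` for every `c`,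
`j(χ.target) ⊆ ψ₀.target` and `j` ANALYTIC on `χ.target`.  The interior chart of `g^*D` on `χ`: trivialization `e_{j c} ∘ fiberCast` of
`(g^*D)_{χ⁻¹ c} = D_{g(χ⁻¹ c)} = D_{ψ₀⁻¹(j c)}`, frame `h ∘ j` (matrix coefficients holomorphic as composites), the SAME reference structure `(H₀, P₀)`,
lattice `Λ` and constant `κ`. [cite: Griffiths1970PeriodsIII, §9] [cite: Schmid1973, §2] [cite: CattaniDeligneKaplan1995, §1 (pp. 483–484)]
[cite: Deligne1970, I.1] -/
def comapAnalytic : (D.comap g).InteriorChart χ P₀ where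
  isPreconnected_target := hconn
  e c := (D.fiberCast (hj c)).trans (C.e (j c))
  h c := C.h (j c)
  analyticOnNhd_h φ w := (C.analyticOnNhd_h φ w).comp hja hjt
  isUnit_h c hc := C.isUnit_h (j c) (hjt hc)
  map_F_eq _ hc q := comapAnalytic_map_F_aux g C χ j hj hjt hc q
  form_eq _ hc x y := comapAnalytic_form_aux g C χ j hj hjt hc x y
  Λ := C.Λ
  fg_Λ := C.fg_Λ
  e_toRat_mem _ hc u := comapAnalytic_toRat_mem_aux g C χ j hj hjt hc u
  exists_e_toRat_eq _ hc v hv := comapAnalytic_exists_toRat_aux g C χ j hj hjt hc v hv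
  κ := C.κ
  κ_pos := C.κ_pos
  mul_hodgeNorm_le _ hc x := comapAnalytic_hodgeNorm_aux g C χ j hj hjt hc x

/-- The frame of the induced chart is `h ∘ j`. [cite: Schmid1973, §2] -/
@[simp] theorem comapAnalytic_h (c : ℂ) : (C.comapAnalytic g χ j hj hjt hja hconn).h c = C.h (j c) := rfl

/-- The lattice of the induced chart is that of `C`. [cite: Schmid1973, §2] -/
@[simp] theorem comapAnalytic_Λ : (C.comapAnalytic g χ j hj hjt hja hconn).Λ = C.Λ := rfl

/-- The comparison constant of the induced chart is that of `C`. [cite: CattaniDeligneKaplan1995, §1 (p. 484)] -/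
@[simp] theorem comapAnalytic_κ : (C.comapAnalytic g χ j hj hjt hja hconn).κ = C.κ := rfl

/-- The trivialization of the induced chart: `fiberCast` followed by `e_{j c}`. [cite: Deligne1970, I.1] -/
theorem comapAnalytic_e_apply (c : ℂ) (y : D.V.fiber (g (χ.symm c))) :
    (C.comapAnalytic g χ j hj hjt hja hconn).e c y = C.e (j c) (D.fiberCast (hj c) y) := rfl

variable {C}

include hjt in
/-- Flat frames read the transport along the image of an in-chart path as the identity (honest fibre types). [cite: Schmid1973, §2] -/
private theorem comapAnalytic_flat_aux (hC : C.IsFlat) (hsrc : ∀ x ∈ χ.source, g x ∈ ψ₀.source) {c c' : ℂ} (hc : c ∈ χ.target)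
    (hc' : c' ∈ χ.target) (γ : Path (χ.symm c) (χ.symm c')) (hγ : ∀ t, γ t ∈ χ.source) (y : D.V.fiber (g (χ.symm c))) :
    C.e (j c') (D.fiberCast (hj c') (D.V.transport ((Path.Homotopic.Quotient.mk γ).map g) y)) = C.e (j c) (D.fiberCast (hj c) y) := by
  rw [← Path.Homotopic.Quotient.mk_map, D.fiberCast_transport (hj c) (hj c') (Path.Homotopic.Quotient.mk (γ.map g.continuous)) y,
    ← Path.Homotopic.Quotient.mk_cast]
  exact hC (hjt hc) (hjt hc') _ (fun t => hsrc _ (hγ t)) _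

/-- **FLATNESS IS INDUCED**: if `C` is flat and `g` maps `χ.source` into `ψ₀.source`, the induced chart of `g^*D` is flat (transport of `g^*D` along an
in-chart path `γ` is transport of `D` along the in-disc path `g ∘ γ`, read as the identity by the flat frame of `C`). [cite: Schmid1973, §2]
[cite: CattaniDeligneKaplan1995, §1 (p. 484)] -/
theorem IsFlat.comapAnalytic (hC : C.IsFlat) (hsrc : ∀ x ∈ χ.source, g x ∈ ψ₀.source) : (C.comapAnalytic g χ j hj hjt hja hconn).IsFlat :=
  fun _ _ hc hc' γ hγ y => comapAnalytic_flat_aux g χ j hj hjt hC hsrc hc hc' γ hγ y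

end Motives.VHSData.InteriorChart

/-! ## §3 `g^*D` is locally charted: interior charts of `D` downstairs, holomorphy of `g` in the charts, puncture charts upstairs -/

namespace Motives.VHSData

variable {S S' : Type} [TopologicalSpace S] [TopologicalSpace S'] {k : ℤ} {D : VHSData S k} (g : C(S', S))
variable {α β ι' : Type*} (ψ : α → OpenPartialHomeomorph S ℂ) (χ : β → OpenPartialHomeomorph S' ℂ) {σ' : ι' → ℂ → S'}
  (han : ∀ a b, AnalyticOnNhd ℂ (fun c => ψ a (g ((χ b).symm c))) ((χ b).target ∩ (χ b).symm ⁻¹' (g ⁻¹' (ψ a).source)))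

include han in
/-- The hypotheses of `InteriorChart.comapAnalytic` for the re-routed chart `R = rerouteChart (χ b) (g⁻¹ ψ_a.source)` shrunk to a small ball around a
point `x` of its source, against the disc `ψ_a` shrunk to the ball of radius `r` around `ψ_a (g x)`: the reindexing `J = ψ_a ∘ g ∘ R⁻¹` satisfies the
base-point identity for every parameter, maps the small ball into the ball downstairs (continuity), is analytic there (`han`; `R⁻¹ = χ_b⁻¹` on the
target), the small ball is preconnected, and `g` maps the small source into the shrunk disc's source. [cite: FritzscheGrauert2002, Ch. I §8, Ch. IV §1] -/
private theorem comapAnalytic_hyps (a : α) (b : β) {x : S'}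
    (hx : x ∈ (rerouteChart (χ b) (g ⁻¹' (ψ a).source) ((ψ a).open_source.preimage g.continuous)).source) {r : ℝ} (hr : 0 < r)
    (hB : Metric.ball (ψ a (g x)) r ⊆ (ψ a).target) :
    ∃ r' > 0, Metric.ball (rerouteChart (χ b) (g ⁻¹' (ψ a).source) ((ψ a).open_source.preimage g.continuous) x) r' ⊆
        (rerouteChart (χ b) (g ⁻¹' (ψ a).source) ((ψ a).open_source.preimage g.continuous)).target ∧
      (∀ c : ℂ, g ((restrBall (rerouteChart (χ b) (g ⁻¹' (ψ a).source) ((ψ a).open_source.preimage g.continuous)) x r').symm c) =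
        (restrBall (ψ a) (g x) r).symm
          (ψ a (g ((rerouteChart (χ b) (g ⁻¹' (ψ a).source) ((ψ a).open_source.preimage g.continuous)).symm c)))) ∧
      MapsTo (fun c => ψ a (g ((rerouteChart (χ b) (g ⁻¹' (ψ a).source) ((ψ a).open_source.preimage g.continuous)).symm c)))
        (restrBall (rerouteChart (χ b) (g ⁻¹' (ψ a).source) ((ψ a).open_source.preimage g.continuous)) x r').target
        (restrBall (ψ a) (g x) r).target ∧
      AnalyticOnNhd ℂ (fun c => ψ a (g ((rerouteChart (χ b) (g ⁻¹' (ψ a).source) ((ψ a).open_source.preimage g.continuous)).symm c)))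
        (restrBall (rerouteChart (χ b) (g ⁻¹' (ψ a).source) ((ψ a).open_source.preimage g.continuous)) x r').target ∧
      IsPreconnected (restrBall (rerouteChart (χ b) (g ⁻¹' (ψ a).source) ((ψ a).open_source.preimage g.continuous)) x r').target ∧
      ∀ x₁ ∈ (restrBall (rerouteChart (χ b) (g ⁻¹' (ψ a).source) ((ψ a).open_source.preimage g.continuous)) x r').source,
        g x₁ ∈ (restrBall (ψ a) (g x) r).source := by
  set R := rerouteChart (χ b) (g ⁻¹' (ψ a).source) ((ψ a).open_source.preimage g.continuous) with hR
  -- `J = ψ_a ∘ g ∘ R⁻¹` is analytic on `R.target` (there `R⁻¹ = χ_b⁻¹`)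
  have hJan : AnalyticOnNhd ℂ (fun c => ψ a (g (R.symm c))) R.target := by
    refine (han a b).congr R.open_target fun c hc => ?_
    show ψ a (g ((χ b).symm c)) = ψ a (g (R.symm c))
    rw [rerouteChart_symm_apply_of_mem (χ b) _ hc]
  have hJx : ψ a (g (R.symm (R x))) = ψ a (g x) := by rw [R.left_inv hx]
  -- a small ball inside `R.target` mapped by `J` into the ball of radius `r` downstairs
  have hopen : IsOpen (R.target ∩ (fun c => ψ a (g (R.symm c))) ⁻¹' Metric.ball (ψ a (g x)) r) :=
    hJan.continuousOn.isOpen_inter_preimage R.open_target Metric.isOpen_ball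
  have hxmem : R x ∈ R.target ∩ (fun c => ψ a (g (R.symm c))) ⁻¹' Metric.ball (ψ a (g x)) r :=
    ⟨R.map_source hx, by rw [mem_preimage, hJx]; exact Metric.mem_ball_self hr⟩
  obtain ⟨r', hr', hB'⟩ := Metric.isOpen_iff.1 hopen (R x) hxmem
  have hB't : Metric.ball (R x) r' ⊆ R.target := fun c hc => (hB' hc).1
  refine ⟨r', hr', hB't, fun c => ?_, fun c hc => ?_, hJan.mono (restrBall_target_subset R x r'), isPreconnected_restrBall_target R hB't,
    fun x₁ hx₁ => ?_⟩
  · -- base-point identity for every parameter: `R⁻¹ c ∈ g⁻¹ ψ_a.source` always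
    have hmem : g (R.symm c) ∈ (ψ a).source := symm_rerouteChart_mem (χ b) _ hx c
    show g (R.symm c) = (ψ a).symm (ψ a (g (R.symm c)))
    rw [(ψ a).left_inv hmem]
  · rw [restrBall_target R hB't] at hc
    rw [restrBall_target (ψ a) hB]
    exact (hB' hc).2
  · obtain ⟨hx₁R, hx₁B⟩ := (mem_restrBall_source R x r').1 hx₁
    refine (mem_restrBall_source (ψ a) (g x) r).2 ⟨hx₁R.2, ?_⟩
    have h2 := (hB' hx₁B).2
    rw [mem_preimage] at h2
    change ψ a (g (R.symm (R x₁))) ∈ Metric.ball (ψ a (g x)) r at h2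
    rwa [R.left_inv hx₁R] at h2

include han in
/-- **`g^*D` IS LOCALLY CHARTED FROM INTERIOR CHARTS OF `D`, HOLOMORPHY OF `g` IN THE CHARTS, AND PUNCTURE CHARTS UPSTAIRS** («the period map of
`g^*𝒱` is `Φ ∘ g`»): `g : S′ → S` continuous, charts `χ_b` of `S′` and discs `ψ_a` of `S` with every `ψ_a ∘ g ∘ χ_b⁻¹` analytic where defined, interior
charts of `D` on coordinate balls around every point of every disc `ψ_a` DOWNSTAIRS, puncture charts of `g^*D` along the ends `σ′ i` UPSTAIRS; then
`g^*D` is locally charted for the charts `rerouteChart (χ b) (g⁻¹ ψ_a.source)` of `S′`. [cite: Griffiths1970PeriodsIII, §9] [cite: Schmid1973, §2]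
[cite: CattaniDeligneKaplan1995, §1 (pp. 483–484)] [cite: FritzscheGrauert2002, Ch. IV §1] -/
theorem IsLocallyCharted.comap_of_analytic
    (hint : ∀ a, ∀ y ∈ (ψ a).source, ∃ r > 0, Metric.ball (ψ a y) r ⊆ (ψ a).target ∧
      ∃ (V : Type) (_ : AddCommGroup V) (_ : Module ℚ V) (_ : FiniteDimensional ℚ V) (H₀ : HodgeStructure V k) (P₀ : H₀.Polarization),
        Nonempty (D.InteriorChart (restrBall (ψ a) y r) P₀))
    (hpunct : ∀ i, ∃ (V : Type) (_ : AddCommGroup V) (_ : Module ℚ V) (_ : FiniteDimensional ℚ V) (L : PolarizedLimitMixedHodgeStructure V k),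
      Nonempty ((D.comap g).PunctureChart (σ' i) L)) :
    (D.comap g).IsLocallyCharted
      (fun ab : α × β => rerouteChart (χ ab.2) (g ⁻¹' (ψ ab.1).source) ((ψ ab.1).open_source.preimage g.continuous)) σ' := by
  refine ⟨fun ab x hx => ?_, hpunct⟩
  obtain ⟨a, b⟩ := ab
  have hgx : g x ∈ (ψ a).source := hx.2
  obtain ⟨r, hr, hB, V, _, _, _, H₀, P₀, ⟨C⟩⟩ := hint a (g x) hgx
  obtain ⟨r', hr', hB', hj, hjt, hja, hconn, -⟩ := comapAnalytic_hyps g ψ χ han a b hx hr hB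
  exact ⟨r', hr', hB', V, inferInstance, inferInstance, inferInstance, H₀, P₀, ⟨C.comapAnalytic g _ _ hj hjt hja hconn⟩⟩

include han in
/-- **`g^*D` IS LOCALLY FLAT-CHARTED FROM FLAT INTERIOR CHARTS OF `D`, HOLOMORPHY OF `g` IN THE CHARTS, AND FLAT PUNCTURE CHARTS UPSTAIRS.**
[cite: Griffiths1970PeriodsIII, §9] [cite: Schmid1973, §2] [cite: CattaniDeligneKaplan1995, §1 (pp. 483–484) and (2.4) (p. 488)] [cite: FritzscheGrauert2002, Ch. IV §1] -/
theorem IsLocallyFlatCharted.comap_of_analytic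
    (hint : ∀ a, ∀ y ∈ (ψ a).source, ∃ r > 0, Metric.ball (ψ a y) r ⊆ (ψ a).target ∧
      ∃ (V : Type) (_ : AddCommGroup V) (_ : Module ℚ V) (_ : FiniteDimensional ℚ V) (H₀ : HodgeStructure V k) (P₀ : H₀.Polarization)
        (C : D.InteriorChart (restrBall (ψ a) y r) P₀), C.IsFlat)
    (hpunct : ∀ i, ∃ (V : Type) (_ : AddCommGroup V) (_ : Module ℚ V) (_ : FiniteDimensional ℚ V) (L : PolarizedLimitMixedHodgeStructure V k)
      (C : (D.comap g).PunctureChart (σ' i) L), C.IsFlat) :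
    (D.comap g).IsLocallyFlatCharted
      (fun ab : α × β => rerouteChart (χ ab.2) (g ⁻¹' (ψ ab.1).source) ((ψ ab.1).open_source.preimage g.continuous)) σ' := by
  refine ⟨fun ab x hx => ?_, hpunct⟩
  obtain ⟨a, b⟩ := ab
  have hgx : g x ∈ (ψ a).source := hx.2
  obtain ⟨r, hr, hB, V, _, _, _, H₀, P₀, C, hC⟩ := hint a (g x) hgx
  obtain ⟨r', hr', hB', hj, hjt, hja, hconn, hsrc⟩ := comapAnalytic_hyps g ψ χ han a b hx hr hB
  exact ⟨r', hr', hB', V, inferInstance, inferInstance, inferInstance, H₀, P₀, C.comapAnalytic g _ _ hj hjt hja hconn,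
    hC.comapAnalytic g _ _ hj hjt hja hconn hsrc⟩

end Motives.VHSData

end Literature.AlgebraicGeometry

end
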